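import Summits.BirchSwinnertonDyer.Rank1Residual.Additive.RamifiedSevenGenusGaloisTransportSums
import Literature.NumberTheory.IwasawaTheory.SinnottNormAsFieldNorm
import Mathlib.NumberTheory.Cyclotomic.Gal
import HarnessLib

set_option autoImplicit false

/-!
# `𝒞₇` genus road (crux `EllipticUnitValueSevenOfGZK`, K7r), the (5)-unit programme (SUMMON GENUS-UNIT-A5), File B3a:
# THE CYCLOTOMIC SIDE — `Σ_{x ∈ (ℤ/m)ˣ} ψ(x) log|1 − e^{2πix/m}| = ψ(b) · Σ_{g ∈ Gal(L/ℚ)} χ(g) log‖Φ(g ξ)‖` for the Sinnott unit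
# `ξ = N_{ℚ(ζ)/L}(1 − ζ)`, `L ⊆ ℚ(ζ)` normal, `Φ(ζ) = e^{2πib/m}` (memo S5 (b1)(b2): the ONLY place the torsor coordinate `b`
# enters; THEOREMS ONLY)

Cell bsd-cm, seat bsd-cm-k-ty1 g26 (literature-prover); ruled memo `pub/bsd-cm/bsd-cm-k-ty1/g26/G45-typing-memo.md`
(c225f82434dc25c5; pen D941/D948/D950/D953).  GENERAL statements (any primitive `m`-th root of unity `ζ ∈ ℚ̄`, any normal
`L ≤ ℚ(ζ)`, any embedding `Φ : ℚ̄ → ℂ`, any character `χ` of `Gal(L/ℚ)` with a Dirichlet READING `ψ` mod `m` at `ζ` in the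
literal shape of D950); no definition, no named fact, no instance.

* §1 `exists_absGal_apply_eq_pow` — for every unit `y` mod `m` an automorphism `σ_y ∈ Gal(ℚ̄/ℚ)` with `σ_y ζ = ζ^y`
  (Mathlib's `IsCyclotomicExtension.autEquivPow` on `ℚ(ζ)`, irreducibility of `Φ_m` over `ℚ`, `liftNormal`);
  `apply_eq_of_apply_eq_of_le_adjoin` — automorphisms agreeing on `ζ` agree on `L ≤ ℚ(ζ)`.
* §2 THE TORSOR COORDINATE: `exists_unit_rootOfUnityPow_eq` — `Φ ζ = e^{2πib/m}` for a unit `b` (`Φ ζ` is a primitive `m`-th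
  root of unity in `ℂ`); `cyclotomicLogSum_eq_mul_sum_units` — `Σ_x ψ(x) log|1 − e^{2πix/m}| = ψ(b)·Σ_y ψ(y) log‖Φ(1 − ζ^y)‖`
  (substitute `x = b·y`; memo S5 (b1)).
* §3 ★ `sum_units_eq_finsum_gal` — `Σ_{y ∈ (ℤ/m)ˣ} ψ(y) log‖Φ(1 − ζ^y)‖ = Σ_{g ∈ Gal(L/ℚ)} χ(g)·log‖Φ(g ξ)‖` for
  `ξ = sinnottNorm L ζ 1 = ∏_{h ∈ Gal(ℚ(ζ)/L)} (1 − ζ^h)`: the map `y ↦ σ_y|_L` is a surjective homomorphism whose kernel, read in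
  `ℤ/m`, is the tree's `sinnottExponents L ζ`; its fibres regroup the product (memo S5 (b2)); and ★★
  `cyclotomicLogSum_eq_mul_finsum_gal` = §2 ∘ §3.

HONEST LABEL: cyclotomic bookkeeping; nothing closes; stmt-BirchSwinnertonDyer-19945 OPEN; K1ᵘ NOT proved; `X12.CMRamifiedSeven`
NOT proved; BSD is claimed for no curve; no summit statement is proved by this seat.

## References
* S. Lang, *Cyclotomic Fields I–II* (1990) Ch. 3 §2 (PDF p. 64: `Σ χ(b) log|1 − ζ^b|`) and §5 Lemma 1 (PDF p. 71) [Lang1990].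
* T. Tsuji, J. Number Theory 78 (1999) §6 (p. 20: `N_{ℚ(μ_t)/ℚ(μ_t)∩k}(1 − ζ_t^a)`) [Tsuji1999].
* L. C. Washington, *Introduction to Cyclotomic Fields* (1997) Thm. 2.5 (`Gal(ℚ(ζ_n)/ℚ) ≅ (ℤ/n)ˣ`) [Washington1997].
* Tree: `CyclotomicColemanMap.lean` (`sinnottExponents`, `sinnottNorm`), `SinnottNormAsFieldNorm.lean`, `CyclotomicUnitRegulator.lean`
  (`rootOfUnityPow`, `cyclotomicLogSum`, `rootOfUnityPow_eq_cexp_pow`), B2a/B2b (`isAlgClosure_rat_algebraicClosure`,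
  `coe_restrictNormal_apply`).
-/

noncomputable section

open scoped NumberField ComplexConjugate
open Field
open Literature.NumberTheory.IwasawaTheory.CyclotomicUnits (rootOfUnityPow cyclotomicLogSum sinnottExponents sinnottNorm
  rootOfUnityPow_eq_cexp_pow mem_sinnottExponents_iff)
open Literature.NumberTheory.ComplexMultiplication.EllipticUnits

namespace Summit.BirchSwinnertonDyer.Rank1Residual.Additive.GenusSeven

variable {m : ℕ} [NeZero m]

/-! ## §1 Automorphisms of `ℚ̄` with prescribed action on `ζ` -/

section Auts

/-- **For every unit `y` mod `m` there is `σ ∈ Gal(ℚ̄/ℚ)` with `σ ζ = ζ^y`** (`Gal(ℚ(ζ)/ℚ) ≅ (ℤ/m)ˣ` since `Φ_m` is irreducible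
over `ℚ`; lift to `ℚ̄`). [cite: Washington1997, Thm. 2.5] -/
theorem exists_absGal_apply_eq_pow {ζ : AlgebraicClosure ℚ} (hζ : IsPrimitiveRoot ζ m) (y : (ZMod m)ˣ) :
    ∃ σ : AlgebraicClosure ℚ ≃ₐ[ℚ] AlgebraicClosure ℚ, σ ζ = ζ ^ ((y : ZMod m)).val := by
  haveI : IsAlgClosure ℚ (AlgebraicClosure ℚ) := isAlgClosure_rat_algebraicClosure
  haveI : Normal ℚ (AlgebraicClosure ℚ) := IsAlgClosure.normal ℚ _
  haveI : Algebra.IsIntegral ℚ (AlgebraicClosure ℚ) := Algebra.IsAlgebraic.isIntegral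
  haveI hcyc : IsCyclotomicExtension {m} ℚ (IntermediateField.adjoin ℚ {ζ}) :=
    IsPrimitiveRoot.intermediateField_adjoin_isCyclotomicExtension ℚ hζ
  have hirr : Irreducible (Polynomial.cyclotomic m ℚ) := Polynomial.cyclotomic.irreducible_rat (NeZero.pos m)
  have hz := IsCyclotomicExtension.zeta_spec m ℚ (IntermediateField.adjoin ℚ {ζ})
  let g : IntermediateField.adjoin ℚ {ζ} ≃ₐ[ℚ] IntermediateField.adjoin ℚ {ζ} :=
    (IsCyclotomicExtension.autEquivPow (IntermediateField.adjoin ℚ {ζ}) hirr).symm y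
  have hgz : g (IsCyclotomicExtension.zeta m ℚ (IntermediateField.adjoin ℚ {ζ})) =
      IsCyclotomicExtension.zeta m ℚ (IntermediateField.adjoin ℚ {ζ}) ^ ((y : ZMod m)).val := by
    have h1 := hz.autToPow_spec ℚ g
    have h2 : hz.autToPow ℚ g = y :=
      (IsCyclotomicExtension.autEquivPow (IntermediateField.adjoin ℚ {ζ}) hirr).apply_symm_apply y
    rw [h2] at h1
    exact h1.symm
  -- `gen = zeta^j`, so `g gen = gen^y`
  have hgen_pow : (IntermediateField.AdjoinSimple.gen ℚ ζ) ^ m = 1 := by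
    apply Subtype.ext
    rw [SubmonoidClass.coe_pow, IntermediateField.AdjoinSimple.coe_gen, hζ.pow_eq_one, OneMemClass.coe_one]
  obtain ⟨j, -, hj⟩ := hz.eq_pow_of_pow_eq_one hgen_pow
  have hggen : g (IntermediateField.AdjoinSimple.gen ℚ ζ) = IntermediateField.AdjoinSimple.gen ℚ ζ ^ ((y : ZMod m)).val := by
    rw [← hj, map_pow, hgz, ← pow_mul, ← pow_mul, mul_comm]
  refine ⟨g.liftNormal (AlgebraicClosure ℚ), ?_⟩
  have h := AlgEquiv.liftNormal_commutes g (AlgebraicClosure ℚ) (IntermediateField.AdjoinSimple.gen ℚ ζ)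
  rw [IntermediateField.algebraMap_apply, IntermediateField.algebraMap_apply, IntermediateField.AdjoinSimple.coe_gen,
    hggen, SubmonoidClass.coe_pow, IntermediateField.AdjoinSimple.coe_gen] at h
  exact h

omit [NeZero m] in
/-- **Automorphisms of `ℚ̄` agreeing on `ζ` agree on `L ≤ ℚ(ζ)`.** [cite: Washington1997, Thm. 2.5] -/
theorem apply_eq_of_apply_eq_of_le_adjoin {ζ : AlgebraicClosure ℚ} {L : IntermediateField ℚ (AlgebraicClosure ℚ)}
    (hL : L ≤ IntermediateField.adjoin ℚ {ζ}) {σ τ : AlgebraicClosure ℚ ≃ₐ[ℚ] AlgebraicClosure ℚ} (h : σ ζ = τ ζ)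
    {x : AlgebraicClosure ℚ} (hx : x ∈ L) : σ x = τ x := by
  let S : IntermediateField ℚ (AlgebraicClosure ℚ) :=
    { carrier := {x | σ x = τ x}
      mul_mem' := fun {a b} ha hb => by simp only [Set.mem_setOf_eq, map_mul] at ha hb ⊢; rw [ha, hb]
      one_mem' := by simp
      add_mem' := fun {a b} ha hb => by simp only [Set.mem_setOf_eq, map_add] at ha hb ⊢; rw [ha, hb]
      zero_mem' := by simp
      algebraMap_mem' := fun q => by simp only [Set.mem_setOf_eq, AlgEquiv.commutes]
      inv_mem' := fun a ha => by simp only [Set.mem_setOf_eq, map_inv₀] at ha ⊢; rw [ha] }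
  have hS : IntermediateField.adjoin ℚ {ζ} ≤ S := IntermediateField.adjoin_le_iff.mpr (Set.singleton_subset_iff.mpr h)
  exact hS (hL hx)

end Auts

/-! ## §2 The torsor coordinate `b`: `Φ(ζ) = e^{2πib/m}`, and the substitution `x = b·y` in the cyclotomic log sum -/

section Torsor

/-- **`Φ ζ = e^{2πi b/m}` for a unit `b` mod `m`** (`Φ ζ` is a primitive `m`-th root of unity in `ℂ`, hence a prime-to-`m`
power of `e^{2πi/m}`).  This `b` is the level-`m` torsor coordinate of the pair `(Φ, ζ)` (memo S1/S5 (b1)).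
[cite: Lang1990, Ch. 3 §1 (PDF p. 61, «ζ a primitive m-th root of unity chosen to be e^{2πi/m}»)] -/
theorem exists_unit_rootOfUnityPow_eq {ζ : AlgebraicClosure ℚ} (hζ : IsPrimitiveRoot ζ m) (Φ : AlgebraicClosure ℚ →+* ℂ) :
    ∃ b : (ZMod m)ˣ, Φ ζ = rootOfUnityPow (b : ZMod m) := by
  have hm : m ≠ 0 := NeZero.ne m
  have hμ : IsPrimitiveRoot (Complex.exp (2 * Real.pi * Complex.I / m)) m := Complex.isPrimitiveRoot_exp m hm
  have hΦζ : IsPrimitiveRoot (Φ ζ) m := hζ.map_of_injective Φ.injective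
  obtain ⟨i, hi, hiζ⟩ := hμ.eq_pow_of_pow_eq_one hΦζ.pow_eq_one
  have hcop : i.Coprime m := (hμ.pow_iff_coprime (NeZero.pos m) i).mp (hiζ ▸ hΦζ)
  refine ⟨ZMod.unitOfCoprime i hcop, ?_⟩
  rw [ZMod.coe_unitOfCoprime, rootOfUnityPow_eq_cexp_pow, ZMod.val_natCast, Nat.mod_eq_of_lt hi, hiζ]

omit [NeZero m] in
/-- `ζ^{(a·c).val} = (ζ^{a.val})^{c.val}` for `ζ^m = 1` (exponents mod `m`). [cite: Lang1990, Ch. 3 §1 (PDF p. 61)] -/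
theorem pow_val_mul {R : Type*} [Monoid R] {ζ : R} (hζm : ζ ^ m = 1) (a c : ZMod m) [NeZero m] :
    ζ ^ (a * c).val = (ζ ^ a.val) ^ c.val := by
  rw [← pow_mul, ZMod.val_mul]
  conv_rhs => rw [← Nat.mod_add_div (a.val * c.val) m, pow_add, pow_mul, hζm, one_pow, mul_one]

/-- **The substitution `x = b·y`** (memo S5 (b1); the ONLY place `ψ(b)` appears): with `Φ ζ = e^{2πib/m}`,
`Σ_{x ∈ (ℤ/m)ˣ} ψ(x)·log|1 − e^{2πix/m}| = ψ(b) · Σ_{y ∈ (ℤ/m)ˣ} ψ(y)·log‖Φ(1 − ζ^{y})‖`.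
[cite: Lang1990, Ch. 3 §2 (PDF p. 64, «∑_{b ∈ Z(m)^*} χ(b) log|1 − ζ^b|»)] -/
theorem cyclotomicLogSum_eq_mul_sum_units {ζ : AlgebraicClosure ℚ} {Φ : AlgebraicClosure ℚ →+* ℂ}
    {b : (ZMod m)ˣ} (hb : Φ ζ = rootOfUnityPow (b : ZMod m)) (ψ : DirichletCharacter ℂ m) :
    cyclotomicLogSum ψ = ψ b * ∑ y : (ZMod m)ˣ, ψ y * (Real.log ‖Φ (1 - ζ ^ ((y : ZMod m)).val)‖ : ℂ) := by
  have hm : m ≠ 0 := NeZero.ne m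
  set μ := Complex.exp (2 * Real.pi * Complex.I / m) with hμdef
  have hμ : IsPrimitiveRoot μ m := Complex.isPrimitiveRoot_exp m hm
  -- `μ^{x} = Φ(ζ^{(b⁻¹ x)})`
  have hkey : ∀ x : (ZMod m)ˣ, rootOfUnityPow (x : ZMod m) = Φ (ζ ^ (((b⁻¹ * x : (ZMod m)ˣ)) : ZMod m).val) := by
    intro x
    rw [map_pow, hb, rootOfUnityPow_eq_cexp_pow, rootOfUnityPow_eq_cexp_pow, ← pow_val_mul hμ.pow_eq_one, ← Units.val_mul,
      mul_inv_cancel_left]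
  rw [Literature.NumberTheory.IwasawaTheory.CyclotomicUnits.cyclotomicLogSum_def, Finset.mul_sum]
  refine Fintype.sum_equiv (Equiv.mulLeft b⁻¹) _ _ fun x => ?_
  rw [Equiv.coe_mulLeft, hkey x, ← map_one Φ, ← map_sub, ← mul_assoc]
  congr 1
  rw [Units.val_mul, ← map_mul, Units.mul_inv_cancel_left]

end Torsor

/-! ## §3 Regrouping `Σ_{y ∈ (ℤ/m)ˣ}` over `Gal(L/ℚ)` for `L ≤ ℚ(ζ)`: the Sinnott norm appears -/

section Regroup

/-- ★ **`Σ_{y ∈ (ℤ/m)ˣ} ψ(y)·log‖Φ(1 − ζ^y)‖ = Σ_{g ∈ Gal(L/ℚ)} χ(g)·log‖Φ(g·ξ)‖`** for `1 < m`, `ζ` a primitive `m`-th root of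
unity, `L ≤ ℚ(ζ)` normal, `χ` a character of `Gal(L/ℚ)` with Dirichlet READING `ψ` at `ζ`, and `ξ ∈ L` with
`ξ = sinnottNorm L ζ 1 = ∏_{h ∈ sinnottExponents L ζ} (1 − ζ^h)` (`= N_{ℚ(ζ)/L}(1 − ζ)`): the map `y ↦ σ_y|_L` is a surjective
homomorphism `(ℤ/m)ˣ → Gal(L/ℚ)` whose kernel read in `ℤ/m` is `sinnottExponents L ζ`; on the fibre over `g` the product of the
`1 − ζ^y` is `g(ξ)` (memo S5 (b2)). [cite: Tsuji1999, §6 (p. 20)] [cite: Washington1997, Thm. 2.5] [cite: Lang1990, Ch. 3 §5 Lemma 1 (PDF p. 71)] -/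
theorem sum_units_eq_finsum_gal (hm : 1 < m) {ζ : AlgebraicClosure ℚ} (hζ : IsPrimitiveRoot ζ m)
    (L : IntermediateField ℚ (AlgebraicClosure ℚ)) [Normal ℚ L] (hL : L ≤ IntermediateField.adjoin ℚ {ζ})
    (Φ : AlgebraicClosure ℚ →+* ℂ) (ψ : DirichletCharacter ℂ m) (χ : (L ≃ₐ[ℚ] L) →* ℂˣ)
    (hread : ∀ (σ : AlgebraicClosure ℚ ≃ₐ[ℚ] AlgebraicClosure ℚ) (g : L ≃ₐ[ℚ] L) (a : ℕ),
      (∀ x : L, ((g x : L) : AlgebraicClosure ℚ) = σ x) → σ ζ = ζ ^ a → χ g = ψ a)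
    (ξ : L) (hξ : (ξ : AlgebraicClosure ℚ) = sinnottNorm (t := m) L ζ 1) :
    ∑ y : (ZMod m)ˣ, ψ y * (Real.log ‖Φ (1 - ζ ^ ((y : ZMod m)).val)‖ : ℂ) =
      ∑ᶠ g : L ≃ₐ[ℚ] L, ((χ g : ℂˣ) : ℂ) * (Real.log ‖Φ ((g ξ : L) : AlgebraicClosure ℚ)‖ : ℂ) := by
  classical
  haveI : IsAlgClosure ℚ (AlgebraicClosure ℚ) := isAlgClosure_rat_algebraicClosure
  haveI : Normal ℚ (AlgebraicClosure ℚ) := IsAlgClosure.normal ℚ _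
  -- the automorphisms `σ_y`, `σ_y ζ = ζ^y`, and the transport `T y = σ_y|_L`
  choose σ hσ using fun y : (ZMod m)ˣ => exists_absGal_apply_eq_pow hζ y
  have hTL : ∀ (y : (ZMod m)ˣ) (x : L), (((σ y).restrictNormal L x : L) : AlgebraicClosure ℚ) = σ y x :=
    fun y x => coe_restrictNormal_apply L (σ y) x
  have hσmul : ∀ (y₁ y₂ : (ZMod m)ˣ) {x : AlgebraicClosure ℚ}, x ∈ L → σ (y₁ * y₂) x = σ y₁ (σ y₂ x) := by
    intro y₁ y₂ x hx
    refine apply_eq_of_apply_eq_of_le_adjoin hL (σ := σ (y₁ * y₂)) (τ := σ y₁ * σ y₂) ?_ hx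
    rw [AlgEquiv.mul_apply, hσ, hσ, map_pow, hσ, Units.val_mul, pow_val_mul hζ.pow_eq_one]
  have hTmul : ∀ y₁ y₂ : (ZMod m)ˣ,
      (σ (y₁ * y₂)).restrictNormal L = (σ y₁).restrictNormal L * (σ y₂).restrictNormal L := by
    intro y₁ y₂
    apply AlgEquiv.ext
    intro x
    apply Subtype.ext
    rw [hTL, AlgEquiv.mul_apply, hTL, hTL]
    exact hσmul y₁ y₂ x.2
  let T : (ZMod m)ˣ →* (L ≃ₐ[ℚ] L) := MonoidHom.mk' (fun y => (σ y).restrictNormal L) hTmul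
  have hT : ∀ y, T y = (σ y).restrictNormal L := fun y => rfl
  -- the reading: `ψ y = χ (T y)`
  have hψ : ∀ y : (ZMod m)ˣ, ψ y = ((χ (T y) : ℂˣ) : ℂ) := fun y => by
    rw [hread (σ y) (T y) ((y : ZMod m)).val (fun x => by rw [hT, hTL]) (hσ y), ZMod.natCast_zmod_val]
  -- the kernel of `T`, read in `ℤ/m`, is `sinnottExponents L ζ`
  have hker : ∀ y : (ZMod m)ˣ, y ∈ T.ker ↔ (y : ZMod m) ∈ sinnottExponents (t := m) L ζ := by
    intro y
    rw [MonoidHom.mem_ker, hT, mem_sinnottExponents_iff]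
    constructor
    · intro h
      refine ⟨σ y, fun x hx => ?_, hσ y⟩
      have h1 := hTL y ⟨x, hx⟩
      rw [h, AlgEquiv.one_apply] at h1
      exact h1.symm
    · rintro ⟨τ, hτL, hτζ⟩
      apply AlgEquiv.ext
      intro x
      apply Subtype.ext
      rw [hTL, AlgEquiv.one_apply]
      rw [apply_eq_of_apply_eq_of_le_adjoin hL (σ := σ y) (τ := absoluteGaloisGroup.toAlgEquiv ℚ τ)
        (by rw [hσ]; exact hτζ.symm) x.2]
      exact hτL x x.2
  -- `T` is surjective
  have hsurj : Function.Surjective T := by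
    intro g
    obtain ⟨τ, hτ⟩ := AlgEquiv.restrictNormalHom_surjective (F := ℚ) (E := AlgebraicClosure ℚ) (K₁ := L) g
    have hrN : AlgEquiv.restrictNormalHom L τ = τ.restrictNormal L := rfl
    rw [hrN] at hτ
    have hτζ : IsPrimitiveRoot (τ ζ) m := hζ.map_of_injective τ.injective
    obtain ⟨a, ha, haζ⟩ := hζ.eq_pow_of_pow_eq_one hτζ.pow_eq_one
    have hcop : a.Coprime m := (hζ.pow_iff_coprime (NeZero.pos m) a).mp (haζ ▸ hτζ)
    refine ⟨ZMod.unitOfCoprime a hcop, ?_⟩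
    rw [← hτ, hT]
    apply AlgEquiv.ext
    intro x
    apply Subtype.ext
    rw [hTL, coe_restrictNormal_apply]
    refine apply_eq_of_apply_eq_of_le_adjoin hL ?_ x.2
    rw [hσ, ZMod.coe_unitOfCoprime, ZMod.val_natCast, Nat.mod_eq_of_lt ha, haζ]
  -- the fibre products: `∏_{y : T y = T y₀} (1 − ζ^y) = σ_{y₀} ξ`
  have hξprod : (ξ : AlgebraicClosure ℚ) = ∏ h ∈ Finset.univ.filter (fun h : (ZMod m)ˣ => h ∈ T.ker),
      (1 - ζ ^ ((h : ZMod m)).val) := by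
    rw [hξ, Literature.NumberTheory.IwasawaTheory.CyclotomicUnits.sinnottNorm,
      finprod_mem_eq_finite_toFinset_prod _ (Set.toFinite _)]
    have hset : (Set.toFinite (sinnottExponents (t := m) L ζ)).toFinset =
        (Finset.univ.filter (fun h : (ZMod m)ˣ => h ∈ T.ker)).image (fun h : (ZMod m)ˣ => (h : ZMod m)) := by
      ext c
      simp only [Set.Finite.mem_toFinset, Finset.mem_image, Finset.mem_filter, Finset.mem_univ, true_and]
      constructor
      · intro hc
        -- `c` is a unit: it is the exponent of an automorphism on the primitive root `ζ`
        obtain ⟨τ, -, hτζ⟩ := (mem_sinnottExponents_iff L ζ c).mp hc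
        have hprim : IsPrimitiveRoot (ζ ^ c.val) m := by
          rw [← hτζ]; exact hζ.map_of_injective (absoluteGaloisGroup.toAlgEquiv ℚ τ).injective
        have hcop : c.val.Coprime m := (hζ.pow_iff_coprime (NeZero.pos m) c.val).mp hprim
        refine ⟨ZMod.unitOfCoprime c.val hcop, ?_, ?_⟩
        · rw [hker, ZMod.coe_unitOfCoprime, ZMod.natCast_zmod_val]; exact hc
        · rw [ZMod.coe_unitOfCoprime, ZMod.natCast_zmod_val]
      · rintro ⟨h, hh, rfl⟩
        exact (hker h).mp hh
    rw [hset, Finset.prod_image (fun h₁ _ h₂ _ hh => Units.ext hh)]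
    refine Finset.prod_congr rfl fun h _ => ?_
    rw [one_mul]
  have hfibre : ∀ y₀ : (ZMod m)ˣ, ∏ y ∈ Finset.univ.filter (fun y : (ZMod m)ˣ => T y = T y₀),
      (1 - ζ ^ ((y : ZMod m)).val) = σ y₀ (ξ : AlgebraicClosure ℚ) := by
    intro y₀
    rw [hξprod, map_prod]
    refine (Finset.prod_bij (fun h _ => y₀ * h) (fun h hh => ?_) (fun h₁ _ h₂ _ hh => mul_left_cancel hh)
      (fun y hy => ⟨y₀⁻¹ * y, ?_, mul_inv_cancel_left y₀ y⟩) (fun h _ => ?_)).symm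
    · simp only [Finset.mem_filter, Finset.mem_univ, true_and, MonoidHom.mem_ker] at hh ⊢
      rw [map_mul, hh, mul_one]
    · simp only [Finset.mem_filter, Finset.mem_univ, true_and, MonoidHom.mem_ker] at hy ⊢
      rw [map_mul, map_inv, hy, inv_mul_cancel]
    · rw [map_sub, map_one, map_pow, hσ, Units.val_mul, pow_val_mul hζ.pow_eq_one]
  -- nonvanishing of the factors (for `Real.log_prod`)
  have hne : ∀ y : (ZMod m)ˣ, ‖Φ (1 - ζ ^ ((y : ZMod m)).val)‖ ≠ 0 := by
    intro y
    rw [norm_ne_zero_iff, map_ne_zero, sub_ne_zero]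
    intro h
    have hdvd := (hζ.pow_eq_one_iff_dvd _).mp h.symm
    have hcop := ZMod.val_coe_unit_coprime y
    have hm1 : m ∣ 1 := by
      have := Nat.Coprime.dvd_of_dvd_mul_left ((Nat.coprime_comm.mp hcop)) (dvd_mul_of_dvd_left hdvd 1)
      simpa using this
    exact absurd (Nat.le_of_dvd one_pos hm1) (not_le.mpr hm)
  -- regroup the sum over the fibres of `T`
  have hmaps : ∀ y ∈ (Finset.univ : Finset (ZMod m)ˣ), T y ∈ Finset.univ.image T :=
    fun y _ => Finset.mem_image_of_mem T (Finset.mem_univ y)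
  rw [← Finset.sum_fiberwise_of_maps_to hmaps]
  have hsupp : (Function.support fun g : L ≃ₐ[ℚ] L =>
      ((χ g : ℂˣ) : ℂ) * (Real.log ‖Φ ((g ξ : L) : AlgebraicClosure ℚ)‖ : ℂ)) ⊆ ↑(Finset.univ.image T) := by
    intro g _
    obtain ⟨y, rfl⟩ := hsurj g
    exact Finset.mem_coe.mpr (Finset.mem_image_of_mem T (Finset.mem_univ y))
  rw [finsum_eq_finsetSum_of_support_subset _ hsupp]
  refine Finset.sum_congr rfl fun g hg => ?_
  obtain ⟨y₀, -, rfl⟩ := Finset.mem_image.mp hg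
  have hinner : ∀ y ∈ Finset.univ.filter (fun y : (ZMod m)ˣ => T y = T y₀),
      ψ y * (Real.log ‖Φ (1 - ζ ^ ((y : ZMod m)).val)‖ : ℂ) =
        ((χ (T y₀) : ℂˣ) : ℂ) * (Real.log ‖Φ (1 - ζ ^ ((y : ZMod m)).val)‖ : ℂ) := by
    intro y hy
    rw [Finset.mem_filter] at hy
    rw [hψ y, hy.2]
  rw [Finset.sum_congr rfl hinner, ← Finset.mul_sum, ← Complex.ofReal_sum,
    ← Real.log_prod (fun y _ => hne y), ← norm_prod, ← map_prod, hfibre y₀, hT, hTL]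

/-- ★★ **THE CYCLOTOMIC SIDE OF THE LEVEL IDENTITY** (memo S5 (b1)+(b2)): `1 < m`, `ζ` a primitive `m`-th root of unity,
`L ≤ ℚ(ζ)` normal, `Φ ζ = e^{2πib/m}`, `χ` a character of `Gal(L/ℚ)` read by `ψ` at `ζ`, `ξ = sinnottNorm L ζ 1 ∈ L`:
`cyclotomicLogSum ψ = ψ(b) · Σ_{g ∈ Gal(L/ℚ)} χ(g)·log‖Φ(g ξ)‖`. [cite: Lang1990, Ch. 3 §5 Lemma 1 (PDF p. 71)] [cite: Tsuji1999, §6 (p. 20)] -/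
theorem cyclotomicLogSum_eq_mul_finsum_gal (hm : 1 < m) {ζ : AlgebraicClosure ℚ} (hζ : IsPrimitiveRoot ζ m)
    (L : IntermediateField ℚ (AlgebraicClosure ℚ)) [Normal ℚ L] (hL : L ≤ IntermediateField.adjoin ℚ {ζ})
    {Φ : AlgebraicClosure ℚ →+* ℂ} {b : (ZMod m)ˣ} (hb : Φ ζ = rootOfUnityPow (b : ZMod m))
    (ψ : DirichletCharacter ℂ m) (χ : (L ≃ₐ[ℚ] L) →* ℂˣ)
    (hread : ∀ (σ : AlgebraicClosure ℚ ≃ₐ[ℚ] AlgebraicClosure ℚ) (g : L ≃ₐ[ℚ] L) (a : ℕ),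
      (∀ x : L, ((g x : L) : AlgebraicClosure ℚ) = σ x) → σ ζ = ζ ^ a → χ g = ψ a)
    (ξ : L) (hξ : (ξ : AlgebraicClosure ℚ) = sinnottNorm (t := m) L ζ 1) :
    cyclotomicLogSum ψ = ψ b * ∑ᶠ g : L ≃ₐ[ℚ] L, ((χ g : ℂˣ) : ℂ) * (Real.log ‖Φ ((g ξ : L) : AlgebraicClosure ℚ)‖ : ℂ) := by
  rw [cyclotomicLogSum_eq_mul_sum_units hb ψ, sum_units_eq_finsum_gal hm hζ L hL Φ ψ χ hread ξ hξ]

end Regroup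

end Summit.BirchSwinnertonDyer.Rank1Residual.Additive.GenusSeven

end
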